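/-
Copyright (c) 2026 the pub-hodgecm-mathlib formalisation cell (harness21).  Prover seat hodgecm-mathlib-B-p14 (g37), 2026-09-01.  Road «S3-tree» (architect A-p16 (g30) A-128∕A-145),
brick T3′ «depth-zero κ-transfer», population (P-2) TYPE (2), row (R2²) «THE FREE ROW», head [T2-d] sub-organ (D2) «THE EIGEN-FIELD PACKAGE», FRAME HALF (R2² holder A-p19 (g26)
20:05:53Z; (D2) holder F0P2-p06 (g11) — field half): THE SYMMETRIC EIGENFRAME OF A RATIONAL UNITARY ELEMENT WITH EIGENVALUES `(u, λ, ι λ)` EXISTS AND HAS DIAGONAL GRAM MATRIX.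
-/
import Literature.NumberTheory.Automorphic.UnitaryGroupFormTransport   -- ★ `formCongr σ T H = (σT)ᵀ H T`
import Mathlib.LinearAlgebra.Matrix.Charpoly.Basic
import Mathlib.LinearAlgebra.Matrix.ToLinearEquiv
import Mathlib.LinearAlgebra.Eigenspace.Basic
import HarnessLib

/-!
# The symmetric eigenframe of a rational unitary element over the eigen-field (Rogawski 1990 Lemma 4.9.3; Jacobowitz 1962 §7)

Topic `NumberTheory/Automorphic`; namespace `Literature.NumberTheory.Automorphic.SymmetricEigenframe`.  THEOREMS ONLY (no definition, no instance, no notation, no named fact, no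
`sorry`); generic: two fields `E →j K`, ring endomorphisms `σ` of `E` and `σK`, `ι` of `K` with `σK ∘ j = j ∘ σ`, `ι ∘ j = j`, `σK ∘ ι = ι ∘ σK`, `ι ∘ ι = id`, `σK ∘ σK = id`.
Cell `pub/hodgecm-mathlib` (D-0151), crux H413 = `stmt-HodgeConjecture-24833`; road «S3-tree», brick T3′, P-2 row (R2²) (holder A-p19 (g26)), head [T2-d] sub-organ (D2), FRAME HALF:
its outputs are VERBATIM the eigenframe inputs `hτ hP hP0 hP1 hP2` of ★ `RationalCyclicSelfDualLattices.exists_selfDual_cyclic_iff_exists_rational_good` (p846609) and `hιd0 hιd1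
hdσ hdne` of ★ `RationalGoodVectorParity.exists_rational_good_iff_even` (p846562).  HONEST LABEL: HC_CM is proved only modulo the 2 remaining named inputs (hLiu418 24832, h413 24833)
until rung 0 closes; elementary linear algebra, asserts nothing printed.

THE MATHEMATICS.  `τ ∈ M₃(E)` unitary for the `σ`-hermitian invertible `J` (`ᵗ(στ)Jτ = J`) with a rational `u`-eigenvector `x₀ ∈ E³` and, over `K`, an eigenvalue `λ` of `τ^K := τ.map j`
such that `ju, λ, ιλ` are pairwise distinct and of norm one (`σu·u = 1`, `σ_K λ·λ = 1`).  A `λ`-eigenvector `x₁ ∈ K³` exists (`det(λ − τ^K) = χ(λ) = 0`), `ι∘x₁` is an `ιλ`-eigenvector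
(`τ^K` has `ι`-fixed entries), and `P := [j∘x₀ | x₁ | ι∘x₁]` is invertible (eigenvectors of distinct eigenvalues), so `τ^K = P·diag(ju, λ, ιλ)·P⁻¹`, with `ι` fixing column `0` and
exchanging columns `1, 2`.  Unitarity gives `⟨τ^K x, τ^K y⟩ = ⟨x, y⟩` for `⟨x, y⟩ := ᵗ(σ_K x)·J^K·y`, hence `(σ_K(γ_a)γ_b − 1)·⟨x_a, x_b⟩ = 0` and `σ_K(γ_a)γ_b = γ_a⁻¹γ_b ≠ 1` for
`a ≠ b`: THE GRAM MATRIX `ᵗ(σ_K P)·J^K·P` IS DIAGONAL, `= diag(j d₀, d₁, ι d₁)` with `d₀ = ⟨x₀, x₀⟩_E`, `d₁ = ⟨x₁, x₁⟩`, `σ_K d₁ = d₁` (hermitian symmetry), all non-zero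
(`det = σ_K(det P)·det J·det P`).

* §1 `gram_apply` (entries of `ᵗ(σM)·H·N`), `gram_conj_diagonal` (sandwich by `diag`), `mulVec_eq_smul_of_isRoot_charpoly` (an eigenvector for a root), `map_mulVec_eigen`
  (`ι` carries eigenvectors of the rational `τ^K`), `det_cols_ne_zero_of_eigen` (three eigenvectors of distinct eigenvalues form an invertible matrix).
* §2 **`exists_symmetric_eigenframe`**.

## References
* [Rogawski1990] J. D. Rogawski, *Automorphic Representations of Unitary Groups in Three Variables* (1990), §4.9 Lemma 4.9.3 p. 56 (eigen-coordinates of the torus).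
* [Jacobowitz1962] R. Jacobowitz, *Hermitian forms over local fields*, Amer. J. Math. 84 (1962), §7 (orthogonal frames and Gram matrices).
* [HornJohnson2013] R. A. Horn, C. R. Johnson, *Matrix Analysis*, 2nd ed. (2013), §1.3 (eigenvectors of distinct eigenvalues are independent; diagonalisation).
-/

set_option autoImplicit false

open Matrix Polynomial

namespace Literature.NumberTheory.Automorphic.SymmetricEigenframe

section Generic

variable {K : Type*} [Field K] {n : Type*} [Fintype n] [DecidableEq n]

omit [DecidableEq n] in
/-- Entries of a Gram matrix: `(ᵗ(M.map σ)·H·N) a b = Σ_i Σ_k σ(M i a)·H i k·N k b`. [cite: Jacobowitz1962, §7] -/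
theorem gram_apply (σ : K →+* K) (M H N : Matrix n n K) (a b : n) :
    ((M.map σ)ᵀ * H * N) a b = ∑ k, ∑ i, σ (M i a) * H i k * N k b := by
  simp only [Matrix.mul_apply, Matrix.transpose_apply, Matrix.map_apply, Finset.sum_mul]

/-- An eigenvector for a root of the characteristic polynomial: `χ_M(λ) = 0 ⇒ ∃ x ≠ 0, M x = λ x`. [cite: HornJohnson2013, §1.3] -/
theorem exists_mulVec_eq_smul_of_isRoot_charpoly (M : Matrix n n K) {lam : K} (h : M.charpoly.IsRoot lam) :
    ∃ x : n → K, x ≠ 0 ∧ M *ᵥ x = lam • x := by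
  have hdet : (Matrix.scalar n lam - M).det = 0 := by rw [← Matrix.eval_charpoly]; exact h
  obtain ⟨x, hx, hMx⟩ := Matrix.exists_mulVec_eq_zero_iff.2 hdet
  refine ⟨x, hx, ?_⟩
  rw [Matrix.sub_mulVec, sub_eq_zero] at hMx
  rw [← hMx]
  ext i
  simp [Matrix.scalar_apply, Matrix.mulVec_diagonal]

omit [DecidableEq n] in
/-- `ι` carries eigenvectors of an `ι`-fixed matrix: `M.map ι = M`, `M x = λ x ⇒ M (ι∘x) = ι(λ)·(ι∘x)`. [cite: HornJohnson2013, §1.3] -/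
theorem map_mulVec_eigen (ι : K →+* K) (M : Matrix n n K) (hM : M.map ι = M) {x : n → K} {lam : K} (hx : M *ᵥ x = lam • x) :
    M *ᵥ (ι ∘ x) = ι lam • (ι ∘ x) := by
  ext i
  have h := RingHom.map_mulVec ι M x i
  rw [hM] at h
  rw [← h, hx, Pi.smul_apply, smul_eq_mul, map_mul, Pi.smul_apply, smul_eq_mul, Function.comp_apply]

/-- **Eigenvectors of pairwise distinct eigenvalues form an invertible matrix**: for `x : m → (n → K)` with `M (x a) = γ_a x a`, `x a ≠ 0`, `γ` injective and `m ≃ n`-many of them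
(here: `Fintype.card m = Fintype.card n` through a square `Matrix.of fun i a => x a i`), the column matrix has non-zero determinant. [cite: HornJohnson2013, §1.3] -/
theorem det_cols_ne_zero_of_eigen (M : Matrix n n K) {γ : n → K} (hγ : Function.Injective γ) {x : n → n → K}
    (hx : ∀ a, M *ᵥ x a = γ a • x a) (hx0 : ∀ a, x a ≠ 0) : (Matrix.of fun i a => x a i).det ≠ 0 := by
  have hli : LinearIndependent K x := by
    refine Module.End.eigenvectors_linearIndependent' (Matrix.mulVecLin M) γ hγ x fun a => ?_
    exact ⟨Module.End.mem_eigenspace_iff.2 (by rw [Matrix.mulVecLin_apply]; exact hx a), hx0 a⟩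
  have hcols : (Matrix.of fun i a => x a i).col = x := by
    funext a i; rfl
  have hU : IsUnit (Matrix.of fun i a => x a i) := Matrix.linearIndependent_cols_iff_isUnit.1 (by rw [hcols]; exact hli)
  exact ((Matrix.isUnit_iff_isUnit_det _).1 hU).ne_zero

end Generic

/-! ## §2 The symmetric eigenframe -/

section Frame

variable {E K : Type*} [Field E] [Field K] (j : E →+* K) (σ : E →+* E) (σK ι : K →+* K)
  (hσj : ∀ x, σK (j x) = j (σ x)) (hιj : ∀ x, ι (j x) = j x) (hσKι : ∀ y, σK (ι y) = ι (σK y)) (hιι : ∀ y, ι (ι y) = y) (hσKσK : ∀ y, σK (σK y) = y)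

include hσj hιj hσKι hιι hσKσK in
/-- **THE SYMMETRIC EIGENFRAME WITH DIAGONAL GRAM MATRIX.**  For `τ ∈ M₃(E)` unitary for the `σ`-hermitian invertible `J`, a rational `u`-eigenvector `x₀ ≠ 0` of `τ`, and an
eigenvalue `λ ∈ K` of `τ^K = τ.map j` with `ju, λ, ιλ` pairwise distinct, `σu·u = 1`, `σ_K λ·λ = 1`: there is `P ∈ GL₃(K)` with columns `[j∘x₀ | x₁ | ι∘x₁]` such that
`τ^K = P·diag(ju, λ, ιλ)·P⁻¹`, `ι` fixes column `0` and exchanges columns `1, 2`, and `ᵗ(σ_K P)·J^K·P = diag(j d₀, d₁, ι d₁)` with `d₀ = Σ σ(x₀ i) J i k x₀ k`, `σ_K d₁ = d₁`,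
`d₁ ≠ 0`, `d₀ ≠ 0`. [cite: Rogawski1990, §4.9 Lemma 4.9.3 p. 56] [cite: Jacobowitz1962, §7] [cite: HornJohnson2013, §1.3] -/
theorem exists_symmetric_eigenframe (J : Matrix (Fin 3) (Fin 3) E) (hJh : (J.map σ)ᵀ = J) (hJ : J.det ≠ 0)
    (τ : Matrix (Fin 3) (Fin 3) E) (hτU : (τ.map σ)ᵀ * J * τ = J)
    {u : E} {x₀ : Fin 3 → E} (hx₀ : τ *ᵥ x₀ = u • x₀) (hx₀0 : x₀ ≠ 0)
    {lam : K} (hlam : ((τ.map j).charpoly).IsRoot lam) (hσlam : σK lam * lam = 1) (hσu : σ u * u = 1)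
    (h01 : j u ≠ lam) (h02 : j u ≠ ι lam) (h12 : lam ≠ ι lam) :
    ∃ P : GL (Fin 3) K, ∃ d₁ : K,
      (τ.map j = (P : Matrix (Fin 3) (Fin 3) K) * diagonal ![j u, lam, ι lam] * ((P⁻¹ : GL (Fin 3) K) : Matrix (Fin 3) (Fin 3) K)) ∧
      (∀ i, (P : Matrix (Fin 3) (Fin 3) K) i 0 = j (x₀ i)) ∧
      (∀ i, ι ((P : Matrix (Fin 3) (Fin 3) K) i 0) = (P : Matrix (Fin 3) (Fin 3) K) i 0) ∧
      (∀ i, ι ((P : Matrix (Fin 3) (Fin 3) K) i 1) = (P : Matrix (Fin 3) (Fin 3) K) i 2) ∧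
      (∀ i, ι ((P : Matrix (Fin 3) (Fin 3) K) i 2) = (P : Matrix (Fin 3) (Fin 3) K) i 1) ∧
      formCongr σK P (J.map j) = diagonal ![j (∑ k, ∑ i, σ (x₀ i) * J i k * x₀ k), d₁, ι d₁] ∧
      σK d₁ = d₁ ∧ d₁ ≠ 0 ∧ (∑ k, ∑ i, σ (x₀ i) * J i k * x₀ k) ≠ 0 := by
  classical
  set τK : Matrix (Fin 3) (Fin 3) K := τ.map j with hτK
  set JK : Matrix (Fin 3) (Fin 3) K := J.map j with hJK
  -- the three eigenvectors over `K`
  obtain ⟨x₁, hx₁0, hx₁⟩ := exists_mulVec_eq_smul_of_isRoot_charpoly τK hlam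
  have hτKι : τK.map ι = τK := by ext a b; simp only [hτK, Matrix.map_apply, hιj]
  have hx₂ : τK *ᵥ (ι ∘ x₁) = ι lam • (ι ∘ x₁) := map_mulVec_eigen ι τK hτKι hx₁
  have hx₀K : τK *ᵥ (j ∘ x₀) = j u • (j ∘ x₀) := by
    ext i
    have h := RingHom.map_mulVec j τ x₀ i
    rw [hx₀, Pi.smul_apply, smul_eq_mul, map_mul] at h
    rw [hτK, ← h, Pi.smul_apply, smul_eq_mul, Function.comp_apply]
  -- the frame `X` and its matrix `P₀`
  set γ : Fin 3 → K := ![j u, lam, ι lam] with hγ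
  set X : Fin 3 → Fin 3 → K := ![j ∘ x₀, x₁, ι ∘ x₁] with hX
  have hXeig : ∀ a, τK *ᵥ X a = γ a • X a := by
    intro a; fin_cases a
    · exact hx₀K
    · exact hx₁
    · exact hx₂
  have hx₂0 : ι ∘ x₁ ≠ 0 := by
    intro h0
    apply hx₁0
    funext i
    have hi := congrFun h0 i
    rw [Function.comp_apply, Pi.zero_apply] at hi
    rw [Pi.zero_apply, ← hιι (x₁ i), hi, map_zero]
  have hx₀K0 : j ∘ x₀ ≠ 0 := by
    intro h0
    apply hx₀0
    funext i
    have hi := congrFun h0 i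
    rw [Function.comp_apply, Pi.zero_apply, map_eq_zero] at hi
    exact hi
  have hX0 : ∀ a, X a ≠ 0 := by
    intro a; fin_cases a
    · exact hx₀K0
    · exact hx₁0
    · exact hx₂0
  have hγne : ∀ a b : Fin 3, a ≠ b → γ a ≠ γ b := by
    intro a b hab
    fin_cases a <;> fin_cases b <;>
      first | exact absurd rfl hab | exact h01 | exact fun h => h01 h.symm | exact h02 | exact fun h => h02 h.symm | exact h12 | exact fun h => h12 h.symm
  have hγinj : Function.Injective γ := fun a b hab => Classical.byContradiction fun hne => hγne a b hne hab
  set P₀ : Matrix (Fin 3) (Fin 3) K := Matrix.of fun i a => X a i with hP₀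
  have hP₀det : P₀.det ≠ 0 := det_cols_ne_zero_of_eigen τK hγinj hXeig hX0
  set P : GL (Fin 3) K := Matrix.GeneralLinearGroup.mkOfDetNeZero P₀ hP₀det with hPdef
  have hPval : (P : Matrix (Fin 3) (Fin 3) K) = P₀ := rfl
  -- `τK · P₀ = P₀ · diag(γ)`
  have hτP : τK * P₀ = P₀ * diagonal γ := by
    ext i a
    rw [Matrix.mul_diagonal, Matrix.mul_apply]
    have h := congrFun (hXeig a) i
    rw [Matrix.mulVec, dotProduct, Pi.smul_apply, smul_eq_mul] at h
    simp only [hP₀, Matrix.of_apply]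
    rw [mul_comm (X a i) (γ a), ← h]
  have hPu : IsUnit P₀.det := isUnit_iff_ne_zero.2 hP₀det
  have hτ : τK = (P : Matrix (Fin 3) (Fin 3) K) * diagonal γ * ((P⁻¹ : GL (Fin 3) K) : Matrix (Fin 3) (Fin 3) K) := by
    rw [Matrix.coe_units_inv, hPval, ← hτP, Matrix.mul_assoc, Matrix.mul_nonsing_inv _ hPu, Matrix.mul_one]
  -- unitarity over `K`
  have hτUK : (τK.map σK)ᵀ * JK * τK = JK := by
    have h := congrArg (fun M : Matrix (Fin 3) (Fin 3) E => M.map j) hτU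
    have hc : (τ.map σ).map j = τK.map σK := by ext a b; simp only [Matrix.map_apply, hσj, hτK]
    simp only [Matrix.map_mul, Matrix.transpose_map] at h
    rw [hc] at h
    exact h
  -- the Gram matrix `G` and its invariance `G = diag(σγ) · G · diag(γ)`
  set G : Matrix (Fin 3) (Fin 3) K := (P₀.map σK)ᵀ * JK * P₀ with hG
  have hGconj : G = diagonal (fun a => σK (γ a)) * G * diagonal γ := by
    calc G = (P₀.map σK)ᵀ * ((τK.map σK)ᵀ * JK * τK) * P₀ := by rw [hτUK]
      _ = ((τK * P₀).map σK)ᵀ * JK * (τK * P₀) := by rw [Matrix.map_mul, Matrix.transpose_mul]; simp only [Matrix.mul_assoc]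
      _ = ((P₀ * diagonal γ).map σK)ᵀ * JK * (P₀ * diagonal γ) := by rw [hτP]
      _ = diagonal (fun a => σK (γ a)) * G * diagonal γ := by
          rw [Matrix.map_mul, Matrix.transpose_mul, diagonal_map (map_zero σK), diagonal_transpose]
          simp only [hG, Matrix.mul_assoc]
  have hγσ : ∀ a, σK (γ a) * γ a = 1 := by
    intro a; fin_cases a
    · show σK (j u) * j u = 1
      rw [hσj, ← map_mul, hσu, map_one]
    · exact hσlam
    · show σK (ι lam) * ι lam = 1
      rw [hσKι, ← map_mul, hσlam, map_one]
  have hγ0 : ∀ a, γ a ≠ 0 := fun a h0 => by have := hγσ a; rw [h0, mul_zero] at this; exact zero_ne_one this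
  have hoff : ∀ a b, a ≠ b → G a b = 0 := by
    intro a b hab
    have h := congrFun (congrFun hGconj a) b
    rw [Matrix.mul_diagonal, Matrix.diagonal_mul] at h
    -- `G a b · (1 − σ(γ a) γ b) = 0` and `σ(γ a) γ b ≠ 1`
    have hne : σK (γ a) * γ b ≠ 1 := by
      intro h1
      apply hγne a b hab
      calc γ a = γ a * (σK (γ a) * γ b) := by rw [h1, mul_one]
        _ = (σK (γ a) * γ a) * γ b := by ring
        _ = γ b := by rw [hγσ a, one_mul]
    have hfac : G a b * (1 - σK (γ a) * γ b) = 0 := by linear_combination h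
    rcases mul_eq_zero.1 hfac with h0 | h0
    · exact h0
    · exact absurd (sub_eq_zero.1 h0).symm hne
  have hGdiag : G = diagonal fun a => G a a := by
    ext a b
    by_cases hab : a = b
    · subst hab; rw [diagonal_apply_eq]
    · rw [diagonal_apply_ne _ hab]; exact hoff a b hab
  -- the diagonal values
  have hJσ : ∀ i k, σK (JK i k) = JK k i := by
    intro i k
    have h := congrFun (congrFun hJh k) i
    rw [Matrix.transpose_apply, Matrix.map_apply] at h
    simp only [hJK, Matrix.map_apply, hσj, h]
  have hG00 : G 0 0 = j (∑ k, ∑ i, σ (x₀ i) * J i k * x₀ k) := by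
    rw [hG, gram_apply]
    simp only [hP₀, Matrix.of_apply, hX, Matrix.cons_val_zero, Function.comp_apply, hJK, Matrix.map_apply, map_sum, map_mul, hσj]
  have hG22 : G 2 2 = ι (G 1 1) := by
    rw [hG, gram_apply, gram_apply]
    simp only [hP₀, Matrix.of_apply, map_sum, map_mul, hJK, Matrix.map_apply, hιj, ← hσKι]
    rfl
  have hG11σ : σK (G 1 1) = G 1 1 := by
    rw [hG, gram_apply]
    simp only [map_sum, map_mul, hσKσK, hJσ]
    rw [Finset.sum_comm]
    refine Finset.sum_congr rfl fun k _ => Finset.sum_congr rfl fun i _ => ?_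
    ring
  -- non-vanishing of the diagonal values
  have hdetG : G.det ≠ 0 := by
    rw [hG, Matrix.det_mul, Matrix.det_mul, Matrix.det_transpose, ← RingHom.mapMatrix_apply, ← RingHom.map_det, hJK, ← RingHom.mapMatrix_apply, ← RingHom.map_det]
    exact mul_ne_zero (mul_ne_zero ((map_ne_zero σK).2 hP₀det) ((map_ne_zero j).2 hJ)) hP₀det
  have hGaa : ∀ a, G a a ≠ 0 := by
    intro a h0
    apply hdetG
    rw [hGdiag, det_diagonal]
    exact Finset.prod_eq_zero (Finset.mem_univ a) h0
  have hd₀ : (∑ k, ∑ i, σ (x₀ i) * J i k * x₀ k) ≠ 0 := fun h0 => hGaa 0 (by rw [hG00, h0, map_zero])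
  -- assemble
  refine ⟨P, G 1 1, hτ, fun i => rfl, fun i => ?_, fun i => rfl, fun i => ?_, ?_, hG11σ, hGaa 1, hd₀⟩
  · show ι (j (x₀ i)) = j (x₀ i)
    exact hιj _
  · show ι (ι (x₁ i)) = x₁ i
    exact hιι _
  · show ((P : Matrix (Fin 3) (Fin 3) K).map σK)ᵀ * JK * (P : Matrix (Fin 3) (Fin 3) K) = _
    rw [hPval, ← hG, hGdiag]
    congr 1
    funext a
    fin_cases a
    · exact hG00
    · rfl
    · exact hG22

end Frame

end Literature.NumberTheory.Automorphic.SymmetricEigenframe
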